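import Literature.AlgebraicGeometry.AbelianSchemes.RigidifiedLineBundleLimitDescentRingBase
import Literature.AlgebraicGeometry.AbelianSchemes.RigidifiedLineBundlePicZeroLocusClosedOfNoetherian
import Literature.AlgebraicGeometry.AbelianSchemes.ClassifyAlongBaseChange
import Literature.AlgebraicGeometry.AbelianSchemes.ClassifyOfAffineOfNoetherian
import HarnessLib

/-!
# Universal property of a Poincaré-type family: from AFFINE test schemes OF FINITE TYPE to ALL test schemes, over an AFFINE
# Noetherian base ([MumfordAV1970] §13, the reduction in the proof of the Theorem p. 125)

Layer `Literature/AlgebraicGeometry/AbelianSchemes`, namespace `Literature.AlgebraicGeometry.AbelianSchemes.AbelianSchemeOver`.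
THEOREMS ONLY (no definition, no named fact, no instance, no notation, no `sorry`).

For abelian schemes `A`, `B` over an AFFINE locally Noetherian scheme `S` and a rank-one `𝒫` on `A ×_S B` rigidified along
`ε_A × 1_B`: the `∃!` of classifying maps `T → B` for rigidified fibrewise-`Pic⁰` line bundles on `A_T` holds for EVERY test scheme
`T → S` as soon as it holds for the AFFINE `T` OF FINITE TYPE over `S` — Mumford's two reductions in the proof of [MumfordAV1970]
§13 Theorem p. 125: «it suffices to consider `T` of finite type» (Noetherian approximation, ★
`existsUnique_classify_affine_of_finiteType_ringBase` with its closedness input ★ `isClosed_picZeroLocus_of_locallyOfFiniteType`) and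
Zariski gluing (★ `existsUnique_classify_of_affine_of_isLocallyNoetherian`, [MilneAV2008] I §8 Thm. 8.9).  The base `S` is only
assumed affine (not a spectrum on the nose): the classification problem is transported along `S ≅ Spec Γ(S, 𝒪_S)` by ★
`ClassifyAlongBaseChange` (solutions over `S` for `(T, f₀ ≫ e⁻¹)` ⟷ solutions over `Spec Γ(S, 𝒪_S)` for `(T, f₀)`).

* `existsUnique_classify_affine_of_finiteType_of_isAffine` — affine finite type ⇒ AFFINE;
* **`existsUnique_classify_of_affine_finiteType_of_isAffine`** — affine finite type ⇒ ALL.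

This is node N0′ «affine finite type ⇒ all `T → S′`» of the F-3 (M) grandchild line `Cruxes/HDel/Lines/F3DualAbelianSchemeMc` (stub
`stub_McN0`; cell `hodgecm-mathlib`, D-0151, FLOOR 0 P1), the relative twin of the ℂ-engine's ★
`Motives/PoincareUniversal/AffineFiniteTypeToAll.stub_M13_0_of_affineFiniteType_holds`.  Count-neutral; HC_CM is proved only modulo
the 7 printed citations until rung 0 closes; nothing here is about HC.

Mathlib searched (pin): `Scheme.isoSpec`, `isLocallyNoetherian_Spec`, `pullback.lift_fst/snd`, `existsUnique_congr` (used); Mathlib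
has no abelian schemes.

## References
* [MumfordAV1970] D. Mumford, *Abelian Varieties* (1970), §13 (Thm. p. 125 and its proof).
* [MilneAV2008] J. S. Milne, *Abelian Varieties* (v2.00, 2008), I §8 pp. 36–37 (Thm. 8.9).
* [StacksProject] The Stacks Project, Tags 01ZC, 0B8W.
* [GortzWedhorn2020] U. Görtz, T. Wedhorn, *Algebraic Geometry I*, 2nd ed. (2020), Thm. 10.57, Thm. 10.60, Section (4.7).
-/

noncomputable section

set_option backward.isDefEq.respectTransparency false

open CategoryTheory CategoryTheory.Limits AlgebraicGeometry

namespace Literature.AlgebraicGeometry.AbelianSchemes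

namespace AbelianSchemeOver

open Literature.AlgebraicGeometry.Modules Literature.AlgebraicGeometry.Motives Literature.AlgebraicGeometry.AbelianVarieties

variable {S : Scheme.{0}} [IsAffine S] [IsLocallyNoetherian S] (A B : AbelianSchemeOver S) (P : (A.prodLeft B).Modules)

/-- **Affine finite type ⇒ AFFINE**, over an affine locally Noetherian base `S` ([MumfordAV1970] §13, «it suffices to consider `T`
of finite type»): for a rank-one `𝒫` on `A ×_S B`, the `∃!` of classifying maps for rigidified fibrewise-`Pic⁰` line bundles on
`A_T` over every AFFINE `T → S` follows from the same over the affine `T → S` of finite type.  Transport along `e : S ≅ Spec K`,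
`K = Γ(S, 𝒪_S)` Noetherian (★ `existsUnique_classify_baseChange_of_existsUnique` / `…_of_existsUnique_baseChange` for the base change
along `e⁻¹`), then the ring-base limit descent ★ `existsUnique_classify_affine_of_finiteType_ringBase` with its closedness input ★
`isClosed_picZeroLocus_of_locallyOfFiniteType`. [cite: MumfordAV1970, §13 (proof of the Thm. p. 125)]
[cite: StacksProject, Tag 01ZC and Tag 0B8W] [cite: GortzWedhorn2020, Thm. 10.57 and Thm. 10.60] -/
theorem existsUnique_classify_affine_of_finiteType_of_isAffine (hP1 : HasRank P 1)
    (haff : ∀ (T : Scheme.{0}) [IsAffine T] (f : T ⟶ S) [LocallyOfFiniteType f] (ℒ : A.RigidifiedLineBundle f),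
      ℒ.FibrewisePicZero →
      ∃! g : {g : T ⟶ B.X.left // g ≫ B.X.hom = f},
        Nonempty ((Scheme.Modules.pullback (A.baseChangeToProd B f g.1 g.2)).obj P ≅ ℒ.L))
    (T : Scheme.{0}) [IsAffine T] (f : T ⟶ S) (ℒ : A.RigidifiedLineBundle f) (hℒ : ℒ.FibrewisePicZero) :
    ∃! g : {g : T ⟶ B.X.left // g ≫ B.X.hom = f},
      Nonempty ((Scheme.Modules.pullback (A.baseChangeToProd B f g.1 g.2)).obj P ≅ ℒ.L) := by
  -- the base `S ≅ Spec K`, `K := Γ(S, 𝒪_S)` Noetherian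
  haveI : IsLocallyNoetherian (Spec Γ(S, ⊤)) := isLocallyNoetherian_of_isOpenImmersion S.isoSpec.inv
  haveI : IsNoetherianRing Γ(S, ⊤) := isLocallyNoetherian_Spec.mp inferInstance
  let e : S ≅ Spec Γ(S, ⊤) := S.isoSpec
  -- the base-changed data over `Spec K`
  let A' : AbelianSchemeOver (Spec Γ(S, ⊤)) := A.baseChange e.inv
  let B' : AbelianSchemeOver (Spec Γ(S, ⊤)) := B.baseChange e.inv
  have w : (pullback.fst A'.X.hom B'.X.hom ≫ pullback.fst A.X.hom e.inv) ≫ A.X.hom =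
      (pullback.snd A'.X.hom B'.X.hom ≫ pullback.fst B.X.hom e.inv) ≫ B.X.hom := by
    have hA : pullback.fst A.X.hom e.inv ≫ A.X.hom = pullback.snd A.X.hom e.inv ≫ e.inv := pullback.condition
    have hB : pullback.fst B.X.hom e.inv ≫ B.X.hom = pullback.snd B.X.hom e.inv ≫ e.inv := pullback.condition
    have hO : pullback.fst A'.X.hom B'.X.hom ≫ pullback.snd A.X.hom e.inv =
        pullback.snd A'.X.hom B'.X.hom ≫ pullback.snd B.X.hom e.inv := pullback.condition
    rw [Category.assoc, hA, ← Category.assoc, hO, Category.assoc, ← hB, Category.assoc]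
  let c : A'.prodLeft B' ⟶ A.prodLeft B :=
    pullback.lift (pullback.fst A'.X.hom B'.X.hom ≫ pullback.fst A.X.hom e.inv)
      (pullback.snd A'.X.hom B'.X.hom ≫ pullback.fst B.X.hom e.inv) w
  have hc₁ : c ≫ pullback.fst A.X.hom B.X.hom = pullback.fst A'.X.hom B'.X.hom ≫ pullback.fst A.X.hom e.inv :=
    pullback.lift_fst _ _ _
  have hc₂ : c ≫ pullback.snd A.X.hom B.X.hom = pullback.snd A'.X.hom B'.X.hom ≫ pullback.fst B.X.hom e.inv :=
    pullback.lift_snd _ _ _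
  let P' : (A'.prodLeft B').Modules := (Scheme.Modules.pullback c).obj P
  have hP1' : HasRank P' 1 := hasRank_pullback c hP1
  -- (i) the hypothesis over `Spec K`: affine finite-type test schemes, for the base-changed data
  have haff' : ∀ (T'' : Scheme.{0}) [IsAffine T''] (f'' : T'' ⟶ Spec (.of Γ(S, ⊤))) [LocallyOfFiniteType f'']
      (ℒ'' : A'.RigidifiedLineBundle f''), ℒ''.FibrewisePicZero →
      ∃! g : {g : T'' ⟶ B'.X.left // g ≫ B'.X.hom = f''},
        Nonempty ((Scheme.Modules.pullback (A'.baseChangeToProd B' f'' g.1 g.2)).obj P' ≅ ℒ''.L) := by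
    intro T'' _ f'' _ ℒ'' hℒ''
    haveI : LocallyOfFiniteType (f'' ≫ e.inv) := inferInstance
    exact A.existsUnique_classify_baseChange_of_existsUnique B P e.inv f'' c hc₁ hc₂ ℒ''
      (haff T'' (f'' ≫ e.inv) ℒ''.alongBaseChange (RigidifiedLineBundle.alongBaseChange_fibrewisePicZero hℒ''))
  -- (ii) write `f = f₀ ≫ e⁻¹` and read `ℒ` on `(A_{Spec K})_{f₀}`
  obtain ⟨f₀, rfl⟩ : ∃ f₀ : T ⟶ Spec Γ(S, ⊤), f₀ ≫ e.inv = f := ⟨f ≫ e.hom, by simp [e]⟩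
  have hrig : Nonempty ((Scheme.Modules.pullback (A'.baseChange f₀).unitSection).obj
      ((Scheme.Modules.pullback (A.bcInvLeft e.inv f₀)).obj ℒ.L) ≅ SheafOfModules.unit _) :=
    ℒ.rigid.map fun r =>
      (Scheme.Modules.pullbackComp _ _).app ℒ.L ≪≫
        (Scheme.Modules.pullbackCongr (by
          rw [← A.unitSection_comp_baseChangeCompGrpIso_hom_left e.inv f₀, Category.assoc,
            A.baseChangeCompGrpIso_hom_left_inv_left e.inv f₀, Category.comp_id])).app ℒ.L ≪≫ r
  let ℒ' : A'.RigidifiedLineBundle f₀ :=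
    ⟨(Scheme.Modules.pullback (A.bcInvLeft e.inv f₀)).obj ℒ.L, hasRank_pullback _ ℒ.hasRank_one, hrig⟩
  -- `ℒ'.alongBaseChange ≅ ℒ` (modules on `A_{f₀ ≫ e⁻¹}`)
  have eℒ : ℒ'.alongBaseChange.L ≅ ℒ.L := A.pullbackHomPullbackInvIso e.inv f₀ ℒ.L
  have hℒ' : ℒ'.FibrewisePicZero := fun Ω _ _ u =>
    (ℒ'.isHomogeneous_fibre_alongBaseChange_iff Ω u).1
      ((RigidifiedLineBundle.isHomogeneous_fibre_iff_of_iso ℒ'.alongBaseChange ℒ eℒ Ω u).2 (hℒ Ω u))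
  -- (iii) the limit descent over `Spec K` for the base-changed data, read back over `S`
  have h' := existsUnique_classify_affine_of_finiteType_ringBase (A := A') (B := B') (P := P') hP1'
    (fun T₁ _ f₁ _ ℒ₁ => A'.isClosed_picZeroLocus_of_locallyOfFiniteType T₁ f₁ ℒ₁) haff' T f₀ ℒ' hℒ'
  have h := A.existsUnique_classify_of_existsUnique_baseChange B P e.inv f₀ c hc₁ hc₂ ℒ' h'
  exact (existsUnique_congr fun g => ⟨fun ⟨i⟩ => ⟨i ≪≫ eℒ⟩, fun ⟨i⟩ => ⟨i ≪≫ eℒ.symm⟩⟩).1 h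

/-- **Affine finite type ⇒ ALL test schemes**, over an affine locally Noetherian base `S` ([MumfordAV1970] §13, the two reductions in
the proof of the Theorem p. 125): for a rank-one `𝒫` on `A ×_S B` rigidified along `ε_A × 1_B`, the `∃!` of classifying maps
`T → B` for rigidified fibrewise-`Pic⁰` line bundles on `A_T` holds for EVERY `T → S` as soon as it holds for the affine `T → S` of
finite type: `existsUnique_classify_affine_of_finiteType_of_isAffine` (affine `T`) + Zariski gluing ★
`existsUnique_classify_of_affine_of_isLocallyNoetherian`. [cite: MumfordAV1970, §13 (Thm. p. 125 and its proof)]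
[cite: MilneAV2008, I §8 (Thm. 8.9, pp. 36–37)] -/
theorem existsUnique_classify_of_affine_finiteType_of_isAffine (hP1 : HasRank P 1)
    (hP : Nonempty ((Scheme.Modules.pullback (A.unitSlice B)).obj P ≅ SheafOfModules.unit _))
    (haff : ∀ (T : Scheme.{0}) [IsAffine T] (f : T ⟶ S) [LocallyOfFiniteType f] (ℒ : A.RigidifiedLineBundle f),
      ℒ.FibrewisePicZero →
      ∃! g : {g : T ⟶ B.X.left // g ≫ B.X.hom = f},
        Nonempty ((Scheme.Modules.pullback (A.baseChangeToProd B f g.1 g.2)).obj P ≅ ℒ.L))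
    {T : Scheme.{0}} (f : T ⟶ S) (ℒ : A.RigidifiedLineBundle f) (hℒ : ℒ.FibrewisePicZero) :
    ∃! g : {g : T ⟶ B.X.left // g ≫ B.X.hom = f},
      Nonempty ((Scheme.Modules.pullback (A.baseChangeToProd B f g.1 g.2)).obj P ≅ ℒ.L) :=
  A.existsUnique_classify_of_affine_of_isLocallyNoetherian B P hP1 hP
    (fun T' _ f' ℒ' hℒ' => A.existsUnique_classify_affine_of_finiteType_of_isAffine B P hP1 haff T' f' ℒ' hℒ') f ℒ hℒ

end AbelianSchemeOver

end Literature.AlgebraicGeometry.AbelianSchemes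

end
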